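import Summits.CriticalPhenomena.PercolationContinuityZ3.Theorems.Transplant.FKConnectivityAllQAntipodalMajThetaBridge
import Summits.CriticalPhenomena.PercolationContinuityZ3.Theorems.Transplant.FKConnectivityAllQAntipodalMinorWeightUpc
import HarnessLib

/-!
# Connectivity correlation inequalities for `φ_{w,q}`, every `q > 0` — file 49c: **the `q`-free `maj₃` inequality on THETA HOSTS WITH
# TWO EARS** — the first hosts without a separating root (`K_{2,3}` and every `B ∥ ear ∥ ear`), every cell with live ear tails

Support file (`--supports stmt-CriticalPhenomena-4575`), FK sub-lane `prim-bschramm-fk-2` (gen 23); builds on p205010 (kernel theorem,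
internal audit signed; external expert review pending).  No definitions, no named facts, no sorries; standard axioms.

Gen 22 left Conjecture `C_∞⁺` at level 3 open exactly for `maj₃` on hosts where every root sees the other two special edges in one top
component of `H ∖ root` (three-spine hosts; memo FROM-fk-2-g22-ORATT §6–§8).  The smallest such host is `K_{2,3}` with one special edge on
each path.  THIS FILE settles the infinite family `H = B ∪ (p₁–c₁–q₁) ∪ (p₂–c₂–q₂)`: `B` ANY two-terminal series–parallel network between
`a, b` not containing `ab`, `z ∈ B` anywhere, two ears through fresh vertices carrying `x = p₁c₁`, `y = p₂c₂` (`{pᵢ,qᵢ} = {a,b}`, either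
orientation), in every cell whose free set contains the ear tails `c₁q₁, c₂q₂` (`N, C ⊆ B ∖ z` arbitrary):
* `FK.theta_U_root`, `FK.theta_U_pivot`, `FK.theta_U_free` — Theorem U (`FK.apUpcCLW_nonneg_of_isTTSP`, every cell, every nonneg
  weight) in one-sided weighted form at the root edge `ab` of `B ∪ {ab}`, at the pivot `z` (Duffin re-rooting), and at `z` with `ab` live
  and unread;
* `FK.theta_pointwise` — `Φ₁₁ − Φ₀₀ ≥ 0` configuration by configuration for antitone `W`;
* **`FK.apPsiCW_maj3_nonpos_of_theta`** — by the bridge (file 49b) `Ψ^W(maj₃, g) = −2∑[g₁₁Φ₁₁ + g₀₀Φ₀₀ + (g₁₀+g₀₁)Φ₁₀]`; `Φ₁₀` is a sum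
  of three Theorem-U functionals (root `ab`; pivot `z` with `ab` contracted; pivot `z` with `ab` deleted), and
  `g₁₁Φ₁₁ + g₀₀Φ₀₀ = ½(g₁₁+g₀₀)(Φ₁₁+Φ₀₀) + ½(g₁₁−g₀₀)(Φ₁₁−Φ₀₀)` with `Φ₁₁+Φ₀₀` = root-U (shifted) + 2·(pivot `z`, `ab` live),
  `g₁₁ ≥ g₀₀` (monotonicity of `g` in the ear tails) and `Φ₁₁ ≥ Φ₀₀` pointwise.  Hence `Z_H(z,q)² Cov_{φ_{z,q}}(maj₃(ω_x,ω_y,ω_z), g) ∈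
  (q−1)·ℝ≥0[z,q]` on these cells (memo `bschramm/FROM-fk-2-g23-THETA.md`; FK-Q2 §32).  Cells with an ear tail contracted or deleted are the
  separating / pendant cases of gen 22 and are not restated here.  Corollaries: partial sums by level
  (`FK.apPsiC_levels_le_maj3_nonpos_of_theta`) and the `q`-form for `0 ≤ q ≤ 1` (`FK.apPsiC_maj3_nonpos_of_theta_of_levels`).
[cite: Grimmett2006, §3.8 Thm. (3.90) (pp. 61–62); §3.9 (pp. 63–64)] [cite: Wagner2006, Thm. 5.8(d), §5.3]
-/

noncomputable section

namespace Summit.CriticalPhenomena.PercolationContinuityZ3.Theorems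

namespace FK

open SimpleGraph Literature.Probability.LatticeModels Literature.Probability.Percolation
open scoped Classical

variable {V : Type*}

section UInstances

variable [Fintype V]

/-- **Theorem U at the root, one-sided weighted form.**  `B` TTSP between `a, b`; `M, C ⊆ B`; `W` antitone; `H` monotone on the subsets of
`M`; `c : ℕ`.  With `A(γ) = k(γ∪C)+k((M\γ)∪C)` and `ι₁ = 1{a↔b in γ∪C}`, `ι₂ = 1{a↔b in (M\γ)∪C}`:
`0 ≤ ∑_{γ ⊆ M} H(γ) (W(A+c+ι₂) − W(A+c+ι₁))` (the root edge `ab` prefers the replica of the complement: `FK.apUpcCLW_nonneg_of_isTTSP`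
with the weight `n ↦ W(n+c) − W(n+c+1) ≥ 0`). [cite: Grimmett2006, §3.8 Thm. (3.90) (pp. 61–62)] -/
theorem theta_U_root {B : Finset (Sym2 V)} {a b : V} (hB : IsTTSP B a b) {M C : Finset (Sym2 V)} (hM : M ⊆ B) (hC : C ⊆ B)
    {W : ℕ → ℝ} (hW : ∀ n, W (n + 1) ≤ W n) {H : Finset (Sym2 V) → ℝ}
    (hH : ∀ ⦃X Y : Finset (Sym2 V)⦄, X ⊆ Y → Y ⊆ M → H X ≤ H Y) (c : ℕ) :
    0 ≤ ∑ γ ∈ M.powerset, H γ *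
        (W (apExpC M C γ + c + (if (openGraph (↑(M \ γ ∪ C) : BondConfig V)).Reachable a b then 1 else 0)) -
          W (apExpC M C γ + c + (if (openGraph (↑(γ ∪ C) : BondConfig V)).Reachable a b then 1 else 0))) := by
  have key := apUpcCLW_nonneg_of_isTTSP hB M C hM hC (fun n => W (n + c) - W (n + c + 1))
    (fun n => sub_nonneg.2 (hW (n + c))) H hH
  unfold apUpcCLW at key
  refine key.trans_eq (Finset.sum_congr rfl fun γ _ => ?_)
  unfold apConn
  by_cases h1 : (openGraph (↑(γ ∪ C) : BondConfig V)).Reachable a b <;>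
    by_cases h2 : (openGraph (↑(M \ γ ∪ C) : BondConfig V)).Reachable a b <;>
    simp only [h1, h2, if_true, if_false, add_zero] <;> ring

/-- **Theorem U at a non-root pivot `z = uv`, one-sided weighted form with the sign `σ = 1 − 2·1{z ∈ γ}`.**  `E` TTSP between `u, v`
(the host minus `z`), `M, C ⊆ E`, `z ∉ M ∪ C`, `W` antitone, `H` monotone on the subsets of `M` and not reading `z`, `c : ℕ`:
`0 ≤ ∑_{γ ⊆ M ∪ {z}} H(γ) σ(γ) W(k(γ∪C)+k(((M∪{z})\γ)∪C) + c)` — the edge `z` prefers the replica of the complement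
(`FK.apUpcCLW_nonneg_of_isTTSP` with the weight `n ↦ W(n−1+c) − W(n+c)`, cf. `FK.apPsiCW_pivot_eq`).
[cite: Grimmett2006, §3.8 Thm. (3.90) (pp. 61–62)] -/
theorem theta_U_pivot {E : Finset (Sym2 V)} {u v : V} (hE : IsTTSP E u v) {M C : Finset (Sym2 V)} (hM : M ⊆ E) (hC : C ⊆ E)
    (hzM : s(u, v) ∉ M)
    {W : ℕ → ℝ} (hW : ∀ n, W (n + 1) ≤ W n) {H : Finset (Sym2 V) → ℝ}
    (hH : ∀ ⦃X Y : Finset (Sym2 V)⦄, X ⊆ Y → Y ⊆ M → H X ≤ H Y) (hHz : ∀ X : Finset (Sym2 V), H (insert s(u, v) X) = H X) (c : ℕ) :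
    0 ≤ ∑ γ ∈ (insert s(u, v) M).powerset, H γ * (if s(u, v) ∈ γ then (-1 : ℝ) else 1) *
        W (apExpC (insert s(u, v) M) C γ + c) := by
  have key := apUpcCLW_nonneg_of_isTTSP hE M C hM hC (fun n => W (n - 1 + c) - W (n + c))
    (fun n => by
      cases n with
      | zero => simp
      | succ k =>
        rw [Nat.add_sub_cancel]
        have := hW (k + c)
        rw [show k + 1 + c = k + c + 1 by ring]
        linarith) H hH
  unfold apUpcCLW at key
  rw [Finset.sum_powerset_insert hzM]
  rw [← Finset.sum_add_distrib]
  refine key.trans_eq (Finset.sum_congr rfl fun γ hγ => ?_)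
  have hγM : γ ⊆ M := Finset.mem_powerset.1 hγ
  have hzγ : s(u, v) ∉ γ := fun h => hzM (hγM h)
  have e1 : insert s(u, v) M \ γ = insert s(u, v) (M \ γ) := Finset.insert_sdiff_of_notMem M hzγ
  have e2 : insert s(u, v) M \ insert s(u, v) γ = M \ γ := by
    rw [Finset.insert_sdiff_insert, Finset.sdiff_insert_of_notMem hzM]
  have hzc : s(u, v) ∉ M \ γ := fun h => hzM (Finset.sdiff_subset h)
  -- the two exponents against the base `apExpC M C γ`
  have k1 := clusterCount_insert_add_ite (γ ∪ C) u v
  have k2 := clusterCount_insert_add_ite (M \ γ ∪ C) u v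
  unfold apExpC
  rw [e1, e2, Finset.insert_union, Finset.insert_union]
  simp only [hzγ, Finset.mem_insert_self, if_true, if_false, hHz]
  unfold apConn
  set p := clusterCount (↑(γ ∪ C) : BondConfig V) ∅ with hp
  set q := clusterCount (↑(M \ γ ∪ C) : BondConfig V) ∅ with hq
  set p' := clusterCount (↑(insert s(u, v) (γ ∪ C)) : BondConfig V) ∅ with hp'
  set q' := clusterCount (↑(insert s(u, v) (M \ γ ∪ C)) : BondConfig V) ∅ with hq'
  by_cases h1 : (openGraph (↑(γ ∪ C) : BondConfig V)).Reachable u v <;>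
    by_cases h2 : (openGraph (↑(M \ γ ∪ C) : BondConfig V)).Reachable u v <;>
    simp only [h1, h2, if_true, if_false, add_zero] at k1 k2 ⊢
  · rw [k1, k2]; ring
  · rw [k1, ← k2, show p + (q' + 1) - 1 + c = p + q' + c by omega]; ring
  · rw [← k1, k2, show p' + 1 + q - 1 + c = p' + q + c by omega]; ring
  · rw [← k1, ← k2, show p' + 1 + q' + c = p' + (q' + 1) + c by ring]; ring

end UInstances

section Theta

variable [Fintype V]

/-- Pointwise sign of the `(11) − (00)` difference of the bridge: for antitone `W`, `σ = ±1`, indicators `ι₁, ι₂ ∈ {0,1}`: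
`0 ≤ 2W(A) − W(A+1+ι₁) − W(A+1+ι₂) + 2σ(W(A+ι₁) − W(A+ι₂))`. [folklore] -/
theorem theta_pointwise {W : ℕ → ℝ} (hW : ∀ n, W (n + 1) ≤ W n) (A : ℕ) (P Q R : Prop) [Decidable P] [Decidable Q] [Decidable R] :
    0 ≤ 2 * W A - W (A + 1 + (if P then 1 else 0)) - W (A + 1 + (if Q then 1 else 0)) +
        2 * (if R then (-1 : ℝ) else 1) * (W (A + (if P then 1 else 0)) - W (A + (if Q then 1 else 0))) := by
  have h1 := hW A
  have h2 := hW (A + 1)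
  by_cases hP : P <;> by_cases hQ : Q <;> by_cases hR : R <;>
    simp only [hP, hQ, hR, if_true, if_false, add_zero] <;> linarith

/-- Contracting the root edge `e = ab` (absent from `M ∪ C`) shifts the cell exponent by the two terminal indicators:
`apExpC M (C ∪ {e}) γ + 2 = apExpC M C γ + 1{a↔b in γ∪C} + 1{a↔b in (M\γ)∪C}`. [cite: Grimmett2006, Thm. (3.1)(a)] -/
theorem apExpC_insert_root_contract {M C γ : Finset (Sym2 V)} {a b : V} :
    apExpC M (insert s(a, b) C) γ + 2 = apExpC M C γ +
      (if (openGraph (↑(γ ∪ C) : BondConfig V)).Reachable a b then 1 else 0) +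
      (if (openGraph (↑(M \ γ ∪ C) : BondConfig V)).Reachable a b then 1 else 0) := by
  unfold apExpC
  have k1 := clusterCount_insert_add_ite (γ ∪ C) a b
  have k2 := clusterCount_insert_add_ite (M \ γ ∪ C) a b
  rw [Finset.union_insert, Finset.union_insert]
  split_ifs at k1 k2 ⊢ <;> omega

/-- The root edge `e = ab` live on the `γ`-side: `apExpC (M ∪ {e}) C (γ ∪ {e}) + 1 = apExpC M C γ + 1{a↔b in γ∪C}` (`e ∉ M`, `γ ⊆ M`).
[cite: Grimmett2006, Thm. (3.1)(a)] -/
theorem apExpC_insert_root_live₁ {M C γ : Finset (Sym2 V)} {a b : V} (heM : s(a, b) ∉ M) :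
    apExpC (insert s(a, b) M) C (insert s(a, b) γ) + 1 = apExpC M C γ +
      (if (openGraph (↑(γ ∪ C) : BondConfig V)).Reachable a b then 1 else 0) := by
  unfold apExpC
  have k1 := clusterCount_insert_add_ite (γ ∪ C) a b
  rw [Finset.insert_sdiff_insert, Finset.sdiff_insert_of_notMem heM, Finset.insert_union]
  split_ifs at k1 ⊢ <;> omega

/-- The root edge `e = ab` live on the complement side: `apExpC (M ∪ {e}) C γ + 1 = apExpC M C γ + 1{a↔b in (M\γ)∪C}` (`e ∉ M`, `γ ⊆ M`).
[cite: Grimmett2006, Thm. (3.1)(a)] -/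
theorem apExpC_insert_root_live₂ {M C γ : Finset (Sym2 V)} {a b : V} (heM : s(a, b) ∉ M) (hγ : γ ⊆ M) :
    apExpC (insert s(a, b) M) C γ + 1 = apExpC M C γ +
      (if (openGraph (↑(M \ γ ∪ C) : BondConfig V)).Reachable a b then 1 else 0) := by
  unfold apExpC
  have k2 := clusterCount_insert_add_ite (M \ γ ∪ C) a b
  have heγ : s(a, b) ∉ γ := fun h => heM (hγ h)
  rw [Finset.insert_sdiff_of_notMem M heγ, Finset.insert_union]
  split_ifs at k2 ⊢ <;> omega


/-- **Theorem U at the pivot `z = uv` with the root edge `e` live and unread**, one-sided weighted form: summing the two positions of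
`e` gives `0 ≤ ∑_{γ ⊆ M ∪ {z}} H(γ) σ(γ) (W(A(γ ∪ {e}) + c) + W(A(γ) + c))` with `A = apExpC (M ∪ {z,e}) C`.
[cite: Grimmett2006, §3.8 Thm. (3.90) (pp. 61–62)] -/
theorem theta_U_free {E : Finset (Sym2 V)} {u v : V} (hE : IsTTSP E u v) {M C : Finset (Sym2 V)} {e : Sym2 V}
    (hM : M ⊆ E) (hC : C ⊆ E) (heE : e ∈ E) (heM : e ∉ M) (hez : e ≠ s(u, v)) (hzM : s(u, v) ∉ M)
    {W : ℕ → ℝ} (hW : ∀ n, W (n + 1) ≤ W n) {H : Finset (Sym2 V) → ℝ}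
    (hH : ∀ ⦃X Y : Finset (Sym2 V)⦄, X ⊆ Y → H X ≤ H Y) (hHz : ∀ X : Finset (Sym2 V), H (insert s(u, v) X) = H X) (c : ℕ) :
    0 ≤ ∑ γ ∈ (insert s(u, v) M).powerset, H γ * (if s(u, v) ∈ γ then (-1 : ℝ) else 1) *
        (W (apExpC (insert e (insert s(u, v) M)) C (insert e γ) + c) + W (apExpC (insert e (insert s(u, v) M)) C γ + c)) := by
  have heM' : e ∉ insert s(u, v) M := by rw [Finset.mem_insert, not_or]; exact ⟨hez, heM⟩
  have key := theta_U_pivot hE (M := insert e M) (Finset.insert_subset heE hM) hC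
    (by rw [Finset.mem_insert, not_or]; exact ⟨hez.symm, hzM⟩) hW (H := fun X => H (X.erase e))
    (fun X Y hXY _ => hH (Finset.erase_subset_erase e hXY))
    (fun X => by
      show H ((insert s(u, v) X).erase e) = H (X.erase e)
      rw [Finset.erase_insert_of_ne hez.symm, hHz]) c
  rw [Finset.insert_comm, Finset.sum_powerset_insert heM', ← Finset.sum_add_distrib] at key
  refine key.trans_eq (Finset.sum_congr rfl fun γ hγ => ?_)
  have hγ' : γ ⊆ insert s(u, v) M := Finset.mem_powerset.1 hγ
  have heγ : e ∉ γ := fun h => heM' (hγ' h)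
  have h1 : (γ.erase e) = γ := Finset.erase_eq_of_notMem heγ
  have h2 : (insert e γ).erase e = γ := Finset.erase_insert heγ
  have h3 : (s(u, v) ∈ insert e γ) = (s(u, v) ∈ γ) := by
    rw [Finset.mem_insert, eq_iff_iff, or_iff_right hez.symm]
  simp only [h1, h2, h3]
  ring


/-- **THEOREM (`q`-free `maj₃` on THETA HOSTS WITH TWO EARS — every cell with live ear tails).**  Let `B` be two-terminal series–parallel
between `a, b` with `ab ∉ B`, `z = uv ∈ B`, and attach two EARS `p₁ – c₁ – q₁`, `p₂ – c₂ – q₂` (`{pᵢ, qᵢ} = {a, b}`, fresh middle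
vertices `c₁ ≠ c₂`); the three special edges are `x = p₁c₁`, `y = p₂c₂`, `z`.  For every cell (`N, C ⊆ B \ z` disjoint: free / contracted,
the rest of `B` deleted; the ear tails `c₁q₁`, `c₂q₂` free), every antitone level weight `w` and every increasing `g` not reading `x, y, z`:
the weighted antipodal form of `maj₃(x,y,z)` against `g` is `≤ 0` — i.e. `Z_H(z,q)² Cov_{φ_{z,q}}(maj₃, g) ∈ (q−1)·ℝ≥0[z,q]` on these
cells of `H = B ∪ ears`.  These are the first hosts with NO separating root (e.g. `K_{2,3}` with one special edge on each path): every root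
sees the other two special edges inside one top component of `H ∖ root` (memo FROM-fk-2-g23-THETA; FK-Q2 §32).  Proof: the bridge
`FK.apPsiCW_maj3_theta_eq`, three Theorem-U instances for the mixed ear states, the pairing `(11)+(00)` = two more instances, and the
pointwise sign of `(11)−(00)` against the increment `g(·∪{f,g}) − g(·) ≥ 0`.
[cite: Grimmett2006, §3.8 Thm. (3.90) (pp. 61–62); §3.9 (pp. 63–64)] [cite: Wagner2006, Thm. 5.8(d), §5.3] -/
theorem apPsiCW_maj3_nonpos_of_theta {B : Finset (Sym2 V)} {a b : V} (hB : IsTTSP B a b) (heB : s(a, b) ∉ B)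
    {c₁ c₂ p₁ q₁ p₂ q₂ : V} (hpq₁ : s(p₁, q₁) = s(a, b)) (hpq₂ : s(p₂, q₂) = s(a, b))
    (hc₁ : ∀ e ∈ B, c₁ ∉ e) (hc₂ : ∀ e ∈ B, c₂ ∉ e) (hc₁₂ : c₁ ≠ c₂)
    {u v : V} (hz : s(u, v) ∈ B) {N C : Finset (Sym2 V)} (hN : N ⊆ B) (hC : C ⊆ B) (hzN : s(u, v) ∉ N) (hzC : s(u, v) ∉ C)
    {w : ℕ → ℝ} (hw : ∀ n : ℕ, w (n + 1) ≤ w n) {g : Finset (Sym2 V) → ℝ}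
    (hgx : ∀ A : Finset (Sym2 V), g (insert s(p₁, c₁) A) = g A) (hgy : ∀ A : Finset (Sym2 V), g (insert s(p₂, c₂) A) = g A)
    (hgz : ∀ A : Finset (Sym2 V), g (insert s(u, v) A) = g A) (hmono : ∀ ⦃X Y : Finset (Sym2 V)⦄, X ⊆ Y → g X ≤ g Y) :
    ∑ γ ∈ (insert s(p₁, c₁) (insert s(c₁, q₁) (insert s(p₂, c₂) (insert s(c₂, q₂) (insert s(u, v) N))))).powerset,
        w (apExpC (insert s(p₁, c₁) (insert s(c₁, q₁) (insert s(p₂, c₂) (insert s(c₂, q₂) (insert s(u, v) N))))) C γ) *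
          ((((fun X : Finset (Sym2 V) => if (s(p₁, c₁) ∈ X ∧ s(p₂, c₂) ∈ X) ∨ (s(p₁, c₁) ∈ X ∧ s(u, v) ∈ X) ∨ (s(p₂, c₂) ∈ X ∧ s(u, v) ∈ X) then (1 : ℝ) else 0) (γ ∪ C)) -
              ((fun X : Finset (Sym2 V) => if (s(p₁, c₁) ∈ X ∧ s(p₂, c₂) ∈ X) ∨ (s(p₁, c₁) ∈ X ∧ s(u, v) ∈ X) ∨ (s(p₂, c₂) ∈ X ∧ s(u, v) ∈ X) then (1 : ℝ) else 0)
                ((insert s(p₁, c₁) (insert s(c₁, q₁) (insert s(p₂, c₂) (insert s(c₂, q₂) (insert s(u, v) N))))) \ γ ∪ C))) *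
            (g (γ ∪ C) - g ((insert s(p₁, c₁) (insert s(c₁, q₁) (insert s(p₂, c₂) (insert s(c₂, q₂) (insert s(u, v) N))))) \ γ ∪ C))) ≤ 0 := by
  -- elementary facts about the data
  have hab : a ≠ b := hB.ne
  have hac₁ : a ≠ c₁ := by
    obtain ⟨e, he, hae⟩ := hB.left_mem; exact fun h => hc₁ e he (h ▸ hae)
  have hbc₁ : b ≠ c₁ := by
    obtain ⟨e, he, hbe⟩ := hB.right_mem; exact fun h => hc₁ e he (h ▸ hbe)
  have hac₂ : a ≠ c₂ := by
    obtain ⟨e, he, hae⟩ := hB.left_mem; exact fun h => hc₂ e he (h ▸ hae)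
  have hbc₂ : b ≠ c₂ := by
    obtain ⟨e, he, hbe⟩ := hB.right_mem; exact fun h => hc₂ e he (h ▸ hbe)
  have hsub : insert s(u, v) (N ∪ C) ⊆ B := Finset.insert_subset hz (Finset.union_subset hN hC)
  have hc₁' : ∀ e ∈ insert s(u, v) (N ∪ C), c₁ ∉ e := fun e he => hc₁ e (hsub he)
  have hc₂' : ∀ e ∈ insert s(u, v) (N ∪ C), c₂ ∉ e := fun e he => hc₂ e (hsub he)
  have hez : s(a, b) ≠ s(u, v) := fun h => heB (h ▸ hz)
  have heN : s(a, b) ∉ N := fun h => heB (hN h)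
  have heC : s(a, b) ∉ C := fun h => heB (hC h)
  have heM : s(a, b) ∉ insert s(u, v) N := by rw [Finset.mem_insert, not_or]; exact ⟨hez, heN⟩
  have hM : insert s(u, v) N ⊆ B := Finset.insert_subset hz hN
  -- the re-rooted host at `z`
  have hR : IsTTSP ((insert s(a, b) B).erase s(u, v)) u v :=
    hB.reroot_erase (Finset.mem_insert_of_mem hz) (insert_ne_singleton_of_isTTSP hB heB _)
  have hNR : N ⊆ (insert s(a, b) B).erase s(u, v) := fun e he =>
    Finset.mem_erase.2 ⟨fun h => hzN (h ▸ he), Finset.mem_insert_of_mem (hN he)⟩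
  have hCR : C ⊆ (insert s(a, b) B).erase s(u, v) := fun e he =>
    Finset.mem_erase.2 ⟨fun h => hzC (h ▸ he), Finset.mem_insert_of_mem (hC he)⟩
  have heR : s(a, b) ∈ (insert s(a, b) B).erase s(u, v) := Finset.mem_erase.2 ⟨hez, Finset.mem_insert_self _ _⟩
  have hCR' : insert s(a, b) C ⊆ (insert s(a, b) B).erase s(u, v) := Finset.insert_subset heR hCR
  have hzC' : s(u, v) ∉ insert s(a, b) C := by rw [Finset.mem_insert, not_or]; exact ⟨hez.symm, hzC⟩
  -- the weight shifted by four levels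
  set W : ℕ → ℝ := fun n => w (n - 4) with hWdef
  have hW : ∀ n, W (n + 1) ≤ W n := by
    intro n
    simp only [hWdef]
    rcases Nat.lt_or_ge n 4 with h | h
    · rw [show n + 1 - 4 = 0 by omega, show n - 4 = 0 by omega]
    · rw [show n + 1 - 4 = (n - 4) + 1 by omega]; exact hw _
  have hwW : ∀ n, w n = W (n + 4) := fun n => by simp only [hWdef, Nat.add_sub_cancel]
  simp_rw [hwW]
  rw [apPsiCW_maj3_theta_eq W hab hpq₁ hpq₂ hac₁ hbc₁ hac₂ hbc₂ hc₁₂ hc₁' hc₂' hzC hgx hgy]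
  -- the four ear-test functions and their properties
  have mono11 : ∀ ⦃X Y : Finset (Sym2 V)⦄, X ⊆ Y →
      g (insert s(c₁, q₁) (insert s(c₂, q₂) (X ∪ C))) + g (X ∪ C) ≤ g (insert s(c₁, q₁) (insert s(c₂, q₂) (Y ∪ C))) + g (Y ∪ C) :=
    fun X Y hXY => add_le_add (hmono (Finset.insert_subset_insert _ (Finset.insert_subset_insert _
      (Finset.union_subset_union hXY le_rfl)))) (hmono (Finset.union_subset_union hXY le_rfl))
  have mono10 : ∀ ⦃X Y : Finset (Sym2 V)⦄, X ⊆ Y →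
      g (insert s(c₁, q₁) (X ∪ C)) + g (insert s(c₂, q₂) (X ∪ C)) ≤ g (insert s(c₁, q₁) (Y ∪ C)) + g (insert s(c₂, q₂) (Y ∪ C)) :=
    fun X Y hXY => add_le_add (hmono (Finset.insert_subset_insert _ (Finset.union_subset_union hXY le_rfl)))
      (hmono (Finset.insert_subset_insert _ (Finset.union_subset_union hXY le_rfl)))
  have nz11 : ∀ X : Finset (Sym2 V), g (insert s(c₁, q₁) (insert s(c₂, q₂) (insert s(u, v) X ∪ C))) + g (insert s(u, v) X ∪ C) =
      g (insert s(c₁, q₁) (insert s(c₂, q₂) (X ∪ C))) + g (X ∪ C) := fun X => by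
    rw [Finset.insert_union, Finset.insert_comm s(c₂, q₂), Finset.insert_comm s(c₁, q₁), hgz, hgz]
  have nz10 : ∀ X : Finset (Sym2 V), g (insert s(c₁, q₁) (insert s(u, v) X ∪ C)) + g (insert s(c₂, q₂) (insert s(u, v) X ∪ C)) =
      g (insert s(c₁, q₁) (X ∪ C)) + g (insert s(c₂, q₂) (X ∪ C)) := fun X => by
    rw [Finset.insert_union, Finset.insert_comm s(c₁, q₁), Finset.insert_comm s(c₂, q₂), hgz, hgz]
  -- the six signed pieces
  have T1 := theta_U_root hB hM hC hW (H := fun X => g (insert s(c₁, q₁) (X ∪ C)) + g (insert s(c₂, q₂) (X ∪ C)))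
    (fun X Y hXY _ => mono10 hXY) 0
  have T4 := theta_U_root hB hM hC hW (H := fun X => g (insert s(c₁, q₁) (insert s(c₂, q₂) (X ∪ C))) + g (X ∪ C))
    (fun X Y hXY _ => mono11 hXY) 1
  have T3 := theta_U_pivot hR hNR hCR hzN hW (H := fun X => g (insert s(c₁, q₁) (X ∪ C)) + g (insert s(c₂, q₂) (X ∪ C)))
    (fun X Y hXY _ => mono10 hXY) nz10 0
  have T2 := theta_U_pivot hR hNR hCR' hzN hW (H := fun X => g (insert s(c₁, q₁) (X ∪ C)) + g (insert s(c₂, q₂) (X ∪ C)))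
    (fun X Y hXY _ => mono10 hXY) nz10 2
  have T5 := theta_U_free hR hNR hCR heR heN hez hzN hW
    (H := fun X => g (insert s(c₁, q₁) (insert s(c₂, q₂) (X ∪ C))) + g (X ∪ C)) mono11 nz11 1
  simp only [add_zero] at T1 T3
  -- exponents of the auxiliary cells in terms of the base exponent
  have T2' : 0 ≤ ∑ γ ∈ (insert s(u, v) N).powerset,
      (g (insert s(c₁, q₁) (γ ∪ C)) + g (insert s(c₂, q₂) (γ ∪ C))) * (if s(u, v) ∈ γ then (-1 : ℝ) else 1) *
        W (apExpC (insert s(u, v) N) C γ + (if (openGraph (↑(γ ∪ C) : BondConfig V)).Reachable a b then 1 else 0) +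
          (if (openGraph (↑(insert s(u, v) N \ γ ∪ C) : BondConfig V)).Reachable a b then 1 else 0)) := by
    refine T2.trans_eq (Finset.sum_congr rfl fun γ _ => ?_)
    rw [apExpC_insert_root_contract]
  have T5' : 0 ≤ ∑ γ ∈ (insert s(u, v) N).powerset,
      (g (insert s(c₁, q₁) (insert s(c₂, q₂) (γ ∪ C))) + g (γ ∪ C)) * (if s(u, v) ∈ γ then (-1 : ℝ) else 1) *
        (W (apExpC (insert s(u, v) N) C γ + (if (openGraph (↑(γ ∪ C) : BondConfig V)).Reachable a b then 1 else 0)) +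
          W (apExpC (insert s(u, v) N) C γ + (if (openGraph (↑(insert s(u, v) N \ γ ∪ C) : BondConfig V)).Reachable a b then 1 else 0))) := by
    refine T5.trans_eq (Finset.sum_congr rfl fun γ hγ => ?_)
    have hγ' : γ ⊆ insert s(u, v) N := Finset.mem_powerset.1 hγ
    rw [apExpC_insert_root_live₁ heM, apExpC_insert_root_live₂ heM hγ']
  -- the pointwise piece
  have T6 : 0 ≤ ∑ γ ∈ (insert s(u, v) N).powerset,
      (g (insert s(c₁, q₁) (insert s(c₂, q₂) (γ ∪ C))) - g (γ ∪ C)) *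
        (2 * W (apExpC (insert s(u, v) N) C γ) -
          W (apExpC (insert s(u, v) N) C γ + 1 + (if (openGraph (↑(γ ∪ C) : BondConfig V)).Reachable a b then 1 else 0)) -
          W (apExpC (insert s(u, v) N) C γ + 1 + (if (openGraph (↑(insert s(u, v) N \ γ ∪ C) : BondConfig V)).Reachable a b then 1 else 0)) +
          2 * (if s(u, v) ∈ γ then (-1 : ℝ) else 1) *
            (W (apExpC (insert s(u, v) N) C γ + (if (openGraph (↑(γ ∪ C) : BondConfig V)).Reachable a b then 1 else 0)) -
              W (apExpC (insert s(u, v) N) C γ + (if (openGraph (↑(insert s(u, v) N \ γ ∪ C) : BondConfig V)).Reachable a b then 1 else 0)))) := by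
    refine Finset.sum_nonneg fun γ _ => mul_nonneg ?_ (theta_pointwise hW _ _ _ _)
    exact sub_nonneg.2 (hmono ((Finset.subset_insert _ _).trans (Finset.subset_insert _ _)))
  -- assemble
  have key := add_nonneg (add_nonneg (add_nonneg (add_nonneg (add_nonneg
    (mul_nonneg zero_le_two T1) (mul_nonneg zero_le_two T2')) (mul_nonneg zero_le_two T3)) T4)
    (mul_nonneg zero_le_two T5')) T6
  rw [Finset.mul_sum, Finset.mul_sum, Finset.mul_sum, Finset.mul_sum, ← Finset.sum_add_distrib, ← Finset.sum_add_distrib,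
    ← Finset.sum_add_distrib, ← Finset.sum_add_distrib, ← Finset.sum_add_distrib] at key
  rw [show ∀ S : ℝ, -2 * S = -(2 * S) from fun S => by ring, neg_nonpos, Finset.mul_sum]
  refine key.trans_eq (Finset.sum_congr rfl fun γ _ => ?_)
  ring

/-- **COROLLARY (partial sums by cluster level): every coefficient — in the edge odds AND in `q` — of `Z_H(z,q)² Cov_{φ_{z,q}}(maj₃, g)/(q−1)`
is nonnegative on the two-ear theta hosts (cells with live ear tails).**
[cite: Grimmett2006, §3.8 Thm. (3.90) (pp. 61–62)] [cite: Wagner2006, Thm. 5.8(d), §5.3] -/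
theorem apPsiC_levels_le_maj3_nonpos_of_theta {B : Finset (Sym2 V)} {a b : V} (hB : IsTTSP B a b) (heB : s(a, b) ∉ B)
    {c₁ c₂ p₁ q₁ p₂ q₂ : V} (hpq₁ : s(p₁, q₁) = s(a, b)) (hpq₂ : s(p₂, q₂) = s(a, b))
    (hc₁ : ∀ e ∈ B, c₁ ∉ e) (hc₂ : ∀ e ∈ B, c₂ ∉ e) (hc₁₂ : c₁ ≠ c₂)
    {u v : V} (hz : s(u, v) ∈ B) {N C : Finset (Sym2 V)} (hN : N ⊆ B) (hC : C ⊆ B) (hzN : s(u, v) ∉ N) (hzC : s(u, v) ∉ C) (J : ℕ)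
    {g : Finset (Sym2 V) → ℝ}
    (hgx : ∀ A : Finset (Sym2 V), g (insert s(p₁, c₁) A) = g A) (hgy : ∀ A : Finset (Sym2 V), g (insert s(p₂, c₂) A) = g A)
    (hgz : ∀ A : Finset (Sym2 V), g (insert s(u, v) A) = g A) (hmono : ∀ ⦃X Y : Finset (Sym2 V)⦄, X ⊆ Y → g X ≤ g Y) :
    ∑ γ ∈ (insert s(p₁, c₁) (insert s(c₁, q₁) (insert s(p₂, c₂) (insert s(c₂, q₂) (insert s(u, v) N))))).powerset with apExpC (insert s(p₁, c₁) (insert s(c₁, q₁) (insert s(p₂, c₂) (insert s(c₂, q₂) (insert s(u, v) N))))) C γ ≤ J,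
        ((((fun X : Finset (Sym2 V) => if (s(p₁, c₁) ∈ X ∧ s(p₂, c₂) ∈ X) ∨ (s(p₁, c₁) ∈ X ∧ s(u, v) ∈ X) ∨ (s(p₂, c₂) ∈ X ∧ s(u, v) ∈ X) then (1 : ℝ) else 0) (γ ∪ C)) -
            ((fun X : Finset (Sym2 V) => if (s(p₁, c₁) ∈ X ∧ s(p₂, c₂) ∈ X) ∨ (s(p₁, c₁) ∈ X ∧ s(u, v) ∈ X) ∨ (s(p₂, c₂) ∈ X ∧ s(u, v) ∈ X) then (1 : ℝ) else 0)
              ((insert s(p₁, c₁) (insert s(c₁, q₁) (insert s(p₂, c₂) (insert s(c₂, q₂) (insert s(u, v) N))))) \ γ ∪ C))) *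
          (g (γ ∪ C) - g ((insert s(p₁, c₁) (insert s(c₁, q₁) (insert s(p₂, c₂) (insert s(c₂, q₂) (insert s(u, v) N))))) \ γ ∪ C))) ≤ 0 := by
  have key := apPsiCW_maj3_nonpos_of_theta hB heB hpq₁ hpq₂ hc₁ hc₂ hc₁₂ hz hN hC hzN hzC (w := fun n => if n ≤ J then (1 : ℝ) else 0)
    (fun n => by
      split_ifs with h1 h2 h2
      · exact le_rfl
      · exact absurd ((Nat.le_succ n).trans h1) h2
      · exact zero_le_one
      · exact le_rfl) hgx hgy hgz hmono
  rw [Finset.sum_filter]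
  refine le_of_eq_of_le (Finset.sum_congr rfl fun γ _ => ?_) key
  split_ifs <;> ring

/-- **COROLLARY (`maj₃` on the two-ear theta hosts for all `0 ≤ q ≤ 1`, cells with live ear tails, via the Abel bridge of `…Qfree`):**
`apPsiC q M C maj₃ g ≤ 0`. [cite: Grimmett2006, §3.8 Thm. (3.90) (pp. 61–62); §3.9 (pp. 63–64)] [cite: Wagner2006, Thm. 5.8(d), §5.3] -/
theorem apPsiC_maj3_nonpos_of_theta_of_levels {q : ℝ} (hq0 : 0 ≤ q) (hq1 : q ≤ 1) {B : Finset (Sym2 V)} {a b : V} (hB : IsTTSP B a b) (heB : s(a, b) ∉ B)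
    {c₁ c₂ p₁ q₁ p₂ q₂ : V} (hpq₁ : s(p₁, q₁) = s(a, b)) (hpq₂ : s(p₂, q₂) = s(a, b))
    (hc₁ : ∀ e ∈ B, c₁ ∉ e) (hc₂ : ∀ e ∈ B, c₂ ∉ e) (hc₁₂ : c₁ ≠ c₂)
    {u v : V} (hz : s(u, v) ∈ B) {N C : Finset (Sym2 V)} (hN : N ⊆ B) (hC : C ⊆ B) (hzN : s(u, v) ∉ N) (hzC : s(u, v) ∉ C)
    {g : Finset (Sym2 V) → ℝ}
    (hgx : ∀ A : Finset (Sym2 V), g (insert s(p₁, c₁) A) = g A) (hgy : ∀ A : Finset (Sym2 V), g (insert s(p₂, c₂) A) = g A)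
    (hgz : ∀ A : Finset (Sym2 V), g (insert s(u, v) A) = g A) (hmono : ∀ ⦃X Y : Finset (Sym2 V)⦄, X ⊆ Y → g X ≤ g Y) :
    apPsiC q (insert s(p₁, c₁) (insert s(c₁, q₁) (insert s(p₂, c₂) (insert s(c₂, q₂) (insert s(u, v) N))))) C
      (fun X => if (s(p₁, c₁) ∈ X ∧ s(p₂, c₂) ∈ X) ∨ (s(p₁, c₁) ∈ X ∧ s(u, v) ∈ X) ∨ (s(p₂, c₂) ∈ X ∧ s(u, v) ∈ X) then 1 else 0) g ≤ 0 :=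
  sum_pow_mul_nonpos_of_levels_le (insert s(p₁, c₁) (insert s(c₁, q₁) (insert s(p₂, c₂) (insert s(c₂, q₂) (insert s(u, v) N))))).powerset
    (apExpC (insert s(p₁, c₁) (insert s(c₁, q₁) (insert s(p₂, c₂) (insert s(c₂, q₂) (insert s(u, v) N))))) C)
    (fun γ => (((fun X : Finset (Sym2 V) => if (s(p₁, c₁) ∈ X ∧ s(p₂, c₂) ∈ X) ∨ (s(p₁, c₁) ∈ X ∧ s(u, v) ∈ X) ∨ (s(p₂, c₂) ∈ X ∧ s(u, v) ∈ X) then (1 : ℝ) else 0) (γ ∪ C)) -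
      ((fun X : Finset (Sym2 V) => if (s(p₁, c₁) ∈ X ∧ s(p₂, c₂) ∈ X) ∨ (s(p₁, c₁) ∈ X ∧ s(u, v) ∈ X) ∨ (s(p₂, c₂) ∈ X ∧ s(u, v) ∈ X) then (1 : ℝ) else 0) ((insert s(p₁, c₁) (insert s(c₁, q₁) (insert s(p₂, c₂) (insert s(c₂, q₂) (insert s(u, v) N))))) \ γ ∪ C))) *
      (g (γ ∪ C) - g ((insert s(p₁, c₁) (insert s(c₁, q₁) (insert s(p₂, c₂) (insert s(c₂, q₂) (insert s(u, v) N))))) \ γ ∪ C)))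
    hq0 hq1 fun J => apPsiC_levels_le_maj3_nonpos_of_theta hB heB hpq₁ hpq₂ hc₁ hc₂ hc₁₂ hz hN hC hzN hzC J hgx hgy hgz hmono

end Theta

end FK

end Summit.CriticalPhenomena.PercolationContinuityZ3.Theorems

end
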